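import Summits.BirchSwinnertonDyer.Rank1Residual.GaloisImage.SmallImageInertiaOrder
import HarnessLib

/-!
# `p ∤ e_p(I) = #ρ̄_{E,p}(I)` ⟹ every `I`-stable line of `E[p]` has an `I`-stable complement; hence
# on every twist-ordinary / unramified-quotient row TAME (`InertiaSplitAt W p I`) ⟺ `p ∤ e_p(I)` —
# the IMAGE-FREE form of parts 1–4 (the bridge "TB-TAME-e3" in full: the census key TAME of
# N10 / N11 / O8 equals p02's tame-tower criterion `3 ∤ e₃`) — part 5 of the O8-TAME kernel theorems
# (cell `b2b-bsdres`, lane CLASS-CLOSURE, seat cc-typer-1 = typer of record N11 / O8;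
# `class-closure/O8/STATEMENT.md` §§12–16, `N11/SUBPARTITION-typed.md` row TAME)

HONEST FRAMING (cell `b2b-bsdres`, run/shared/lean/b2b/bsd-rank1-residual/, verbatim in every
file): the goal of the cell is to DELETE the COMBINATION-SHAPED residual classes of the
Birch–Swinnerton-Dyer formula for ALL analytic-rank `≤ 1` elliptic curves over `ℚ` — "full BSD
formula for every rank `≤ 1` curve in class `C`" assembled STRICTLY from published theorems — so
that the rank-`≤ 1` remainder becomes exactly the CONSTRUCTION-SHAPED classes, which are TYPED
(missing-input `Prop`s), NOT attempted. This is not "finishing BSD". Lane CLASS-CLOSURE: research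
routes, no claim beyond the stated classes; census output = EVIDENCE, never a Literature fact;
NOTHING is booked here. This file contains THEOREMS ONLY (finite group theory of the image of
`ρ̄_{E,p}` and linear algebra on the `𝔽_p`-plane `E[p]`, over tree predicates); no definition, no
named fact, no conjecture, no `sorry`.

## What is proved

`ρ̄ = galoisRepTorsion W p`, `I ≤ Γ_ℚ` any subgroup, `e_p(I) := Nat.card (I.map ρ̄) = #ρ̄(I)`.
Parts 1–3 assumed a SMALL IMAGE (`Irr W p ∧ ¬ Surj W p`); everything there used only "no element
of order `p` in the image", so the same arguments run under the LOCAL hypothesis `p ∤ e_p(I)`: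

* §10 `smul_eq_self_of_unipotent_of_not_dvd_card` — `p ∤ e_p(I)` ⟹ no `τ ∈ I` acts unipotently
  and non-trivially (`ρ̄(τ)` would have order `p ∣ e_p(I)`); `smul_comm_of_stableLine_of_not_dvd_card`
  — the image of `I` is abelian as soon as `I` stabilises a line (commutator unipotent).
* §11 `exists_stable_complement_of_stableLine_of_not_dvd_card` — **`p ∤ e_p(I)` ⟹ every
  `I`-stable line `L ≤ E[p]` has an `I`-stable complement** (Maschke for the cyclic-by-… image, by
  hand: eigenline of a `σ₀ ∈ I` with distinct scalars on `L`, `E[p]/L`; else `σ^{p−1}` is unipotent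
  for every `σ ∈ I`, hence trivial, so `I` acts by scalars) — verbatim part 3's proof.
* §12 **TAME ⟺ `p ∤ e_p(I)` on ordinary-type rows:**
  `inertiaSplitAt_iff_not_dvd_card_of_twistedOrdinaryLineAt` (rows with `E[p]|_I ≅ (1 ∗; 0 χ)`,
  `χ ≠ 1`: every (M) / `I₀*` row of N10 / N11 / O8 at `3`, by `TwistedOrdinaryLineOfTwist.lean`) and
  `inertiaSplitAt_iff_not_dvd_card_of_unramifiedQuotientLineAt` (good ordinary / multiplicative
  primes): `⟸` by §11 (the complement of the fixed line is the stable line; resp. the stable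
  complement of the unramified-quotient line is fixed, `(σ−1)Y ⊆ X ⊓ Y = 0`), `⟹` by part 4's
  `not_dvd_card_map_galoisRepTorsion_of_inertiaSplitAt`.

READING (class-closure, `N11/SUBPARTITION-typed.md` row TAME, `O8/STATEMENT.md` §16): the census
key TAME (`InertiaSplitAt W 3 I_𝔓`: "E♭[3] has a non-zero point over ℚ₃^nr", keys P2/P3 of
`MixedCongruenceTameness.lean`) is, on EVERY twist-ordinary row of N10 / N11 / O8 — surjective image
or not — EQUIVALENT to p02's tame-tower datum `3 ∤ e₃` (row T-b9,
`GaloisImage/ThreeTorsionInertiaTame.lean`); so the TAME / WILD split of N11's rows is exactly the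
`3 ∤ e₃` / `3 ∣ e₃` split, and O8 ⊆ TAME is the statement `3 ∤ e₃` (part 4, all O8 rows). Nothing
about BSD_p; N10 / N11 / O8 marks unchanged; nothing is booked.

References: J.-P. Serre, Invent. Math. 15 (1972) §2.4 Prop. 15, §1.11 [Serre1972]; J.-P. Serre,
*Local Fields* Ch. IV §2 Cor. 1–3 [SerreLocalFields1979]; B. Edixhoven (1997) §4.2
[Edixhoven1997Serre]; class-closure/O8/STATEMENT.md §§12–16.
-/

set_option autoImplicit false

noncomputable section

open scoped Classical

open WeierstrassCurve Literature.NumberTheory.EllipticCurves Literature.NumberTheory.GaloisRepresentations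
  Field IsDedekindDomain NumberField
  Literature.NumberTheory.EllipticCurves.Rank1Residual
  Summit.BirchSwinnertonDyer.Rank1Residual.Additive.MixedCongruence

namespace Summit.BirchSwinnertonDyer.Rank1Residual.GaloisImage

variable {W : WeierstrassCurve ℚ} [W.IsElliptic] {p : ℕ} [Fact p.Prime]

/-! ## §10. `p ∤ e_p(I)`: no unipotent element of `I`, abelian image on a stable line -/

omit [W.IsElliptic] in
/-- **`p ∤ #ρ̄(I)` ⟹ no unipotent element in `I`.** If `τ ∈ I` acts unipotently on `E[p]`
(`τ (τ Q − Q) = τ Q − Q`) then it acts trivially: otherwise `ρ̄(τ) ∈ ρ̄(I)` has order `p`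
(`galoisRepTorsion_pow_prime_eq_one_of_unipotent`). [cite: SerreLocalFields1979, Ch. IV §2 Cor. 1–3] -/
theorem smul_eq_self_of_unipotent_of_not_dvd_card {I : Subgroup (absoluteGaloisGroup ℚ)}
    (hI : ¬ p ∣ Nat.card (I.map (galoisRepTorsion W p))) {τ : absoluteGaloisGroup ℚ} (hτ : τ ∈ I)
    (h : ∀ Q : geomTorsion W (p : ℤ), τ • (τ • Q - Q) = τ • Q - Q)
    (Q : geomTorsion W (p : ℤ)) : τ • Q = Q := by
  have hp : p.Prime := Fact.out
  by_contra hQ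
  have hpow : galoisRepTorsion W p τ ^ p = 1 :=
    galoisRepTorsion_pow_prime_eq_one_of_unipotent W p h
  have hne : galoisRepTorsion W p τ ≠ 1 := fun h1 ↦
    hQ ((galoisRepTorsion_eq_one_iff' W (p : ℤ) τ).mp h1 Q)
  have hord : orderOf (galoisRepTorsion W p τ) = p := by
    rcases (Nat.dvd_prime hp).mp (orderOf_dvd_of_pow_eq_one hpow) with h1 | h1
    · exact absurd (orderOf_eq_one_iff.mp h1) hne
    · exact h1
  have h2 : orderOf (galoisRepTorsion W p τ) ∣ Nat.card (I.map (galoisRepTorsion W p)) :=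
    Subgroup.orderOf_dvd_natCard _ (Subgroup.mem_map_of_mem (galoisRepTorsion W p) hτ)
  rw [hord] at h2
  exact hI h2

omit [W.IsElliptic] in
/-- Line-stabiliser form: under `p ∤ #ρ̄(I)`, a `τ ∈ I` fixing a line `L` pointwise and acting
trivially on `E[p]/L` acts trivially. [cite: SerreLocalFields1979, Ch. IV §2 Cor. 1–3] -/
theorem smul_eq_self_of_fix_line_of_not_dvd_card {I : Subgroup (absoluteGaloisGroup ℚ)}
    (hI : ¬ p ∣ Nat.card (I.map (galoisRepTorsion W p))) {L : AddSubgroup (geomTorsion W (p : ℤ))}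
    {τ : absoluteGaloisGroup ℚ} (hτ : τ ∈ I) (hfix : ∀ P ∈ L, τ • P = P)
    (hquot : ∀ P, τ • P - P ∈ L) (Q : geomTorsion W (p : ℤ)) : τ • Q = Q :=
  smul_eq_self_of_unipotent_of_not_dvd_card hI hτ (fun P ↦ hfix _ (hquot P)) Q

/-- **`p ∤ #ρ̄(I)` and `I` stabilises a line ⟹ the image of `I` is abelian** (the commutator of two
elements of `I` fixes `L` pointwise and acts trivially on `E[p]/L`). Part 1's
`smul_comm_of_stableLine_of_irr_of_not_surj` with the local hypothesis.
[cite: SerreLocalFields1979, Ch. IV §2 Cor. 1–3] -/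
theorem smul_comm_of_stableLine_of_not_dvd_card {I : Subgroup (absoluteGaloisGroup ℚ)}
    (hI : ¬ p ∣ Nat.card (I.map (galoisRepTorsion W p))) {L : AddSubgroup (geomTorsion W (p : ℤ))}
    (hL : Nat.card L = p) (hst : ∀ σ ∈ I, ∀ P ∈ L, σ • P ∈ L)
    {τ τ' : absoluteGaloisGroup ℚ} (hτ : τ ∈ I) (hτ' : τ' ∈ I) (P : geomTorsion W (p : ℤ)) :
    τ • τ' • P = τ' • τ • P := by
  obtain ⟨c, hc⟩ := exists_int_forall_mem_smul_eq_zsmul hL (hst τ hτ)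
  obtain ⟨c', hc'⟩ := exists_int_forall_mem_smul_eq_zsmul hL (hst τ' hτ')
  obtain ⟨a, ha⟩ := exists_int_forall_smul_sub_zsmul_mem hL (hst τ hτ)
  obtain ⟨a', ha'⟩ := exists_int_forall_smul_sub_zsmul_mem hL (hst τ' hτ')
  have hcommL : ∀ x ∈ L, τ • τ' • x = τ' • τ • x := by
    intro x hx
    rw [hc' x hx, smul_comm τ c' x, hc x hx, hc' _ (L.zsmul_mem hx c), smul_comm c' c x]
  have hcommQ : ∀ R, τ • τ' • R - τ' • τ • R ∈ L := by
    intro R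
    obtain ⟨y, hy⟩ : ∃ y, y = τ • R - a • R := ⟨_, rfl⟩
    obtain ⟨y', hy'⟩ : ∃ y', y' = τ' • R - a' • R := ⟨_, rfl⟩
    have hyL : y ∈ L := hy ▸ ha R
    have hy'L : y' ∈ L := hy' ▸ ha' R
    have e1 : τ • R = y + a • R := by rw [hy, sub_add_cancel]
    have e2 : τ' • R = y' + a' • R := by rw [hy', sub_add_cancel]
    have h : τ • τ' • R - τ' • τ • R = (τ • y' - a • y') - (τ' • y - a' • y) := by
      rw [e2, e1, smul_add, smul_add, smul_comm τ a' R, smul_comm τ' a R, e1, e2]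
      generalize τ • y' = t₁
      generalize τ' • y = t₂
      module
    rw [h]
    exact L.sub_mem (L.sub_mem (hst τ hτ y' hy'L) (L.zsmul_mem hy'L a))
      (L.sub_mem (hst τ' hτ' y hyL) (L.zsmul_mem hyL a'))
  obtain ⟨κ, hκ⟩ : ∃ κ : absoluteGaloisGroup ℚ, κ = τ * τ' * τ⁻¹ * τ'⁻¹ := ⟨_, rfl⟩
  have hκI : κ ∈ I := by
    rw [hκ]
    exact I.mul_mem (I.mul_mem (I.mul_mem hτ hτ') (I.inv_mem hτ)) (I.inv_mem hτ')
  have hκact : ∀ R : geomTorsion W (p : ℤ), κ • R = τ • τ' • τ⁻¹ • τ'⁻¹ • R := fun R ↦ by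
    rw [hκ, mul_smul, mul_smul, mul_smul]
  have hinvL : ∀ {σ : absoluteGaloisGroup ℚ}, σ ∈ I → ∀ x ∈ L, σ⁻¹ • x ∈ L :=
    fun hσ x hx ↦ hst _ (I.inv_mem hσ) x hx
  have hκfix : ∀ x ∈ L, κ • x = x := by
    intro x hx
    rw [hκact, hcommL _ (hinvL hτ _ (hinvL hτ' x hx)), smul_inv_smul, smul_inv_smul]
  have hκquot : ∀ R, κ • R - R ∈ L := by
    intro R
    have h := hcommQ (τ⁻¹ • τ'⁻¹ • R)
    have e1 : τ • τ' • τ⁻¹ • τ'⁻¹ • R = κ • R := (hκact R).symm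
    have e2 : τ' • τ • τ⁻¹ • τ'⁻¹ • R = R := by rw [smul_inv_smul, smul_inv_smul]
    rwa [e1, e2] at h
  have hκtriv := smul_eq_self_of_fix_line_of_not_dvd_card hI hκI hκfix hκquot
  have h := hκtriv (τ' • τ • P)
  rw [hκact, inv_smul_smul, inv_smul_smul] at h
  exact h

/-! ## §11. `p ∤ e_p(I)` ⟹ every `I`-stable line has an `I`-stable complement -/

/-- **`p ∤ #ρ̄(I)` ⟹ every `I`-stable line `L ≤ E[p]` has an `I`-stable complement** (part 3's
`exists_stable_complement_of_stableLine_of_irr_of_not_surj` under the local hypothesis; same proof).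
[cite: SerreLocalFields1979, Ch. IV §2 Cor. 1–3] [cite: Edixhoven1997Serre, §4.2 (PDF p. 297)] -/
theorem exists_stable_complement_of_stableLine_of_not_dvd_card {I : Subgroup (absoluteGaloisGroup ℚ)}
    (hI : ¬ p ∣ Nat.card (I.map (galoisRepTorsion W p))) {L : AddSubgroup (geomTorsion W (p : ℤ))}
    (hL : Nat.card L = p) (hst : ∀ σ ∈ I, ∀ P ∈ L, σ • P ∈ L) :
    ∃ Y : AddSubgroup (geomTorsion W (p : ℤ)), Nat.card Y = p ∧ L ⊓ Y = ⊥ ∧ L ⊔ Y = ⊤ ∧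
      ∀ σ ∈ I, ∀ P ∈ Y, σ • P ∈ Y := by
  have hp : p.Prime := Fact.out
  by_cases hsplit : ∃ σ₀ ∈ I, ∃ a c : ℤ, (∀ P ∈ L, σ₀ • P = c • P) ∧ (∀ P, σ₀ • P - a • P ∈ L) ∧
      ((a - c : ℤ) : ZMod p) ≠ 0
  · obtain ⟨σ₀, hσ₀, a, c, hc, ha, hac⟩ := hsplit
    obtain ⟨Y, hY⟩ := exists_eigenAddSubgroup (W := W) (p := p) σ₀ a
    obtain ⟨Q₀, hQ₀⟩ := exists_not_mem_of_natCard_eq hL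
    obtain ⟨y₀, hy₀⟩ : ∃ y₀, y₀ = σ₀ • Q₀ - a • Q₀ := ⟨_, rfl⟩
    have hy₀L : y₀ ∈ L := hy₀ ▸ ha Q₀
    have hσQ₀ : σ₀ • Q₀ = y₀ + a • Q₀ := by rw [hy₀, sub_add_cancel]
    obtain ⟨P₁, hP₁⟩ : ∃ P₁, P₁ = (a - c) • Q₀ + y₀ := ⟨_, rfl⟩
    have hP₁Y : P₁ ∈ Y := by
      rw [hY, hP₁, smul_add, hc y₀ hy₀L, smul_comm σ₀ (a - c) Q₀, hσQ₀]
      module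
    have hP₁L : P₁ ∉ L := by
      intro h
      apply hQ₀
      have h2 : (a - c) • Q₀ ∈ L := by
        have h3 := L.sub_mem h hy₀L
        rwa [hP₁, add_sub_cancel_right] at h3
      exact mem_of_zsmul_mem hac h2
    have hYbot : Y ≠ ⊥ := by
      intro h
      apply hP₁L
      have h0 : P₁ = 0 := by rw [← AddSubgroup.mem_bot, ← h]; exact hP₁Y
      rw [h0]
      exact L.zero_mem
    have hYL : Y ⊓ L = ⊥ := by
      rw [eq_bot_iff]
      intro P hP
      rw [AddSubgroup.mem_inf] at hP
      rw [AddSubgroup.mem_bot]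
      apply eq_zero_of_zsmul_eq_zero hac
      rw [sub_smul, ← (hY P).mp hP.1, hc P hP.2, sub_self]
    have hYcard : Nat.card Y = p := natCard_eq_of_ne_bot_of_inf_eq_bot hYbot hL hYL
    have hne : L ≠ Y := by
      intro h
      rw [h, inf_idem] at hYL
      have h1 : Nat.card Y = 1 := by rw [hYL]; exact AddSubgroup.card_bot
      exact hp.one_lt.ne' (hYcard.symm.trans h1)
    refine ⟨Y, hYcard, by rwa [inf_comm] at hYL,
      sup_eq_top_of_ne (Literature.NumberTheory.EllipticCurves.natCard_geomTorsion W p) hL hYcard hne,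
      ?_⟩
    intro τ hτ P hP
    rw [hY] at hP ⊢
    rw [smul_comm_of_stableLine_of_not_dvd_card hI hL hst hσ₀ hτ P, hP, smul_comm τ a P]
  · push Not at hsplit
    have hscalar : ∀ σ ∈ I, ∃ c : ℤ, ∀ P : geomTorsion W (p : ℤ), σ • P = c • P := by
      intro σ hσ
      obtain ⟨c, hc⟩ := exists_int_forall_mem_smul_eq_zsmul hL (hst σ hσ)
      obtain ⟨a, ha⟩ := exists_int_forall_smul_sub_zsmul_mem hL (hst σ hσ)
      have hac : ((a - c : ℤ) : ZMod p) = 0 := hsplit σ hσ a c hc ha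
      have hN : ∀ P, σ • P - c • P ∈ L := by
        intro P
        obtain ⟨m, hm⟩ := (ZMod.intCast_zmod_eq_zero_iff_dvd _ p).mp hac
        have h : σ • P - c • P = (σ • P - a • P) + m • ((p : ℤ) • P) := by
          rw [smul_smul, show m * (p : ℤ) = a - c by linarith]
          generalize σ • P = s
          module
        rw [h, natCast_zsmul_eq_zero, smul_zero, add_zero]
        exact ha P
      have hc0 : (c : ZMod p) ≠ 0 := intCast_ne_zero_of_forall_mem_smul_eq_zsmul hL hc
      have hcp : ((c ^ (p - 1) : ℤ) : ZMod p) = 1 := by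
        rw [Int.cast_pow]
        exact ZMod.pow_card_sub_one_eq_one hc0
      have hiter := pow_succ_smul_eq_of_forall_mem hc hN (p - 2)
      have hp2 : p - 2 + 1 = p - 1 := by have := hp.two_le; omega
      rw [hp2] at hiter
      have hfix : ∀ x ∈ L, σ ^ (p - 1) • x = x := by
        intro x hx
        rw [hiter, hc x hx, sub_self, smul_zero, add_zero, zsmul_eq_self_of_intCast_eq_one hcp]
      have hquot : ∀ P, σ ^ (p - 1) • P - P ∈ L := by
        intro P
        rw [hiter, zsmul_eq_self_of_intCast_eq_one hcp, add_sub_cancel_left]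
        exact L.zsmul_mem (hN P) _
      have htriv :=
        smul_eq_self_of_fix_line_of_not_dvd_card hI (I.pow_mem hσ (p - 1)) hfix hquot
      have hcoef : (((((p - 2 : ℕ) : ℤ) + 1) * c ^ (p - 2) : ℤ) : ZMod p) ≠ 0 := by
        have e1 : (((p - 2 : ℕ) : ℤ) + 1 : ℤ) = ((p - 1 : ℕ) : ℤ) := by
          have := hp.two_le
          push_cast [Nat.cast_sub this, Nat.cast_sub hp.one_lt.le]
          ring
        rw [e1, Int.cast_mul, Int.cast_pow, Int.cast_natCast, Nat.cast_sub hp.one_lt.le,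
          Nat.cast_one, ZMod.natCast_self, zero_sub, neg_one_mul, neg_ne_zero]
        exact pow_ne_zero _ hc0
      refine ⟨c, fun P ↦ ?_⟩
      have h := htriv P
      rw [hiter, zsmul_eq_self_of_intCast_eq_one hcp, add_eq_left] at h
      rw [← sub_eq_zero]
      exact eq_zero_of_zsmul_eq_zero hcoef h
    obtain ⟨Q₀, hQ₀⟩ := exists_not_mem_of_natCard_eq hL
    have hQ₀0 : Q₀ ≠ 0 := fun h ↦ hQ₀ (h ▸ L.zero_mem)
    have hord : addOrderOf Q₀ = p :=
      addOrderOf_eq_prime (by rw [← natCast_zsmul]; exact natCast_zsmul_eq_zero Q₀) hQ₀0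
    have hY : Nat.card (AddSubgroup.zmultiples Q₀) = p := by rw [Nat.card_zmultiples, hord]
    have hne : L ≠ AddSubgroup.zmultiples Q₀ := fun h ↦ hQ₀ (h ▸ AddSubgroup.mem_zmultiples Q₀)
    refine ⟨AddSubgroup.zmultiples Q₀, hY, (line_eq_or_inf_eq_bot hL hY).resolve_left hne,
      sup_eq_top_of_ne (Literature.NumberTheory.EllipticCurves.natCard_geomTorsion W p) hL hY hne,
      fun σ hσ P hP ↦ ?_⟩
    obtain ⟨c, hc⟩ := hscalar σ hσ
    rw [hc P]
    exact AddSubgroup.zsmul_mem _ hP c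

/-! ## §12. TAME ⟺ `p ∤ e_p(I)` on ordinary-type rows -/

/-- **Twisted-ordinary shape and `p ∤ #ρ̄(I)` ⟹ inertia-split**: the `I`-stable complement (§11)
of the FIXED line is the stable line of `InertiaSplitAt`. Image-free form of part 2's
`inertiaSplitAt_of_twistedOrdinaryLineAt_of_irr_of_not_surj`.
[cite: SerreLocalFields1979, Ch. IV §2 Cor. 1–3] [cite: Edixhoven1997Serre, §4.2 (PDF p. 297)] -/
theorem inertiaSplitAt_of_twistedOrdinaryLineAt_of_not_dvd_card {I : Subgroup (absoluteGaloisGroup ℚ)}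
    (hI : ¬ p ∣ Nat.card (I.map (galoisRepTorsion W p))) (hE : TwistedOrdinaryLineAt W p I) :
    InertiaSplitAt W p I := by
  obtain ⟨L, hL, hfix, -⟩ := hE
  have hst : ∀ σ ∈ I, ∀ P ∈ L, σ • P ∈ L := fun σ hσ P hP ↦ by
    rw [hfix σ hσ P hP]; exact hP
  obtain ⟨Y, hY, hinf, hsup, hYst⟩ := exists_stable_complement_of_stableLine_of_not_dvd_card hI hL hst
  exact ⟨Y, L, hY, hL, by rwa [inf_comm], by rwa [sup_comm], hYst, hfix⟩

/-- **Unramified-quotient shape and `p ∤ #ρ̄(I)` ⟹ inertia-split**: the `I`-stable complement `Y`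
(§11) of the unramified-quotient line `X` is FIXED pointwise, since `(σ − 1)Y ⊆ X ⊓ Y = 0`.
Image-free form of part 2's `inertiaSplitAt_of_unramifiedQuotientLineAt_of_irr_of_not_surj`.
[cite: SerreLocalFields1979, Ch. IV §2 Cor. 1–3] [cite: Edixhoven1997Serre, §4.2 (PDF p. 297)] -/
theorem inertiaSplitAt_of_unramifiedQuotientLineAt_of_not_dvd_card
    {I : Subgroup (absoluteGaloisGroup ℚ)} (hI : ¬ p ∣ Nat.card (I.map (galoisRepTorsion W p)))
    (hA : UnramifiedQuotientLineAt W p I) : InertiaSplitAt W p I := by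
  obtain ⟨X, hX, hXsub⟩ := hA
  have hst : ∀ σ ∈ I, ∀ P ∈ X, σ • P ∈ X := fun σ hσ P hP ↦ by
    have h : σ • P = (σ • P - P) + P := by abel
    rw [h]
    exact X.add_mem (hXsub σ hσ P) hP
  obtain ⟨Y, hY, hinf, hsup, hYst⟩ := exists_stable_complement_of_stableLine_of_not_dvd_card hI hX hst
  refine ⟨X, Y, hX, hY, hinf, hsup, hst, fun σ hσ P hP ↦ ?_⟩
  have hd : σ • P - P ∈ X ⊓ Y :=
    AddSubgroup.mem_inf.mpr ⟨hXsub σ hσ P, Y.sub_mem (hYst σ hσ P hP) hP⟩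
  rw [hinf, AddSubgroup.mem_bot, sub_eq_zero] at hd
  exact hd

/-- **TB-TAME-e3: on a twisted-ordinary row, TAME ⟺ `p ∤ e_p(I)`.** For `E[p]|_I ≅ (1 ∗; 0 χ)`,
`χ ≠ 1` (every (M) / `I₀*` row of N10 / N11 / O8 at `p = 3`, surjective image or not):
`InertiaSplitAt W p I ↔ ¬ p ∣ #ρ̄_{E,p}(I)` — the census key TAME equals p02's tame-tower datum.
[cite: SerreLocalFields1979, Ch. IV §2 Cor. 1–3] [cite: Edixhoven1997Serre, §4.2 (PDF p. 297)] -/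
theorem inertiaSplitAt_iff_not_dvd_card_of_twistedOrdinaryLineAt
    {I : Subgroup (absoluteGaloisGroup ℚ)} (hE : TwistedOrdinaryLineAt W p I) :
    InertiaSplitAt W p I ↔ ¬ p ∣ Nat.card (I.map (galoisRepTorsion W p)) :=
  ⟨not_dvd_card_map_galoisRepTorsion_of_inertiaSplitAt,
    fun hI ↦ inertiaSplitAt_of_twistedOrdinaryLineAt_of_not_dvd_card hI hE⟩

/-- **On an unramified-quotient row (good ordinary / multiplicative `p`), TAME ⟺ `p ∤ e_p(I)`.**
[cite: SerreLocalFields1979, Ch. IV §2 Cor. 1–3] [cite: Edixhoven1997Serre, §4.2 (PDF p. 297)] -/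
theorem inertiaSplitAt_iff_not_dvd_card_of_unramifiedQuotientLineAt
    {I : Subgroup (absoluteGaloisGroup ℚ)} (hA : UnramifiedQuotientLineAt W p I) :
    InertiaSplitAt W p I ↔ ¬ p ∣ Nat.card (I.map (galoisRepTorsion W p)) :=
  ⟨not_dvd_card_map_galoisRepTorsion_of_inertiaSplitAt,
    fun hI ↦ inertiaSplitAt_of_unramifiedQuotientLineAt_of_not_dvd_card hI hA⟩

/-- **Any stable line and `p ∤ #ρ̄(I)` ⟹ a stable pair** (semisimple), and conversely (part 4): on a
row where `I` stabilises some line of `E[p]`, "`E[p]|_I` is a direct sum of two characters"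
⟺ `p ∤ e_p(I)`. [cite: Edixhoven1997Serre, §4.2 (PDF p. 297)] -/
theorem exists_stablePair_iff_not_dvd_card_of_stableLine {I : Subgroup (absoluteGaloisGroup ℚ)}
    (hL : ∃ L : AddSubgroup (geomTorsion W (p : ℤ)), Nat.card L = p ∧ ∀ σ ∈ I, ∀ P ∈ L, σ • P ∈ L) :
    (∃ X Y : AddSubgroup (geomTorsion W (p : ℤ)), Nat.card X = p ∧ Nat.card Y = p ∧
      X ⊓ Y = ⊥ ∧ X ⊔ Y = ⊤ ∧
      (∀ σ ∈ I, ∀ P ∈ X, σ • P ∈ X) ∧ (∀ σ ∈ I, ∀ P ∈ Y, σ • P ∈ Y)) ↔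
    ¬ p ∣ Nat.card (I.map (galoisRepTorsion W p)) := by
  refine ⟨not_dvd_card_map_galoisRepTorsion_of_stablePair, fun hI ↦ ?_⟩
  obtain ⟨L, hL, hst⟩ := hL
  obtain ⟨Y, hY, hinf, hsup, hYst⟩ := exists_stable_complement_of_stableLine_of_not_dvd_card hI hL hst
  exact ⟨L, Y, hL, hY, hinf, hsup, hst, hYst⟩

end Summit.BirchSwinnertonDyer.Rank1Residual.GaloisImage

end
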